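import Literature.Analysis.ValidatedNumerics.TaylorModelPoly
import HarnessLib

/-!
# An expression language evaluated in Taylor-model arithmetic

Trunk T-ANA (Analysis/ValidatedNumerics); namespace `Literature.Analysis.ValidatedNumerics.PolyMP`.
Sequel of `TaylorModel.lean` / `TaylorModelPoly.lean`. To certify a long polynomial expression in
several parameter-dependent quantities `v₀(ρ), v₁(ρ), …` (each already enclosed by a Taylor model)
one does not want to chain the soundness lemmas `tmem_add`, `tmem_mul`, … by hand. This file
provides the reflective layer: a term language `TExpr` (rational constants, inputs, `+`, `−`, `×`,
unary `−`, integer multiples, division by a natural number), its real semantics `TExpr.evalF`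
(a function of the parameter `ρ`), its Taylor-model evaluation `TExpr.evalT`, and the single
soundness theorem `TExpr.tmem_evalT`: if every input function is enclosed by the corresponding
input model, then `evalF` is enclosed by `evalT` (structural induction; the analogue for Taylor
models of the natural interval extension, Moore 1966, Thm 3.1, and of Makino–Berz's Taylor-model
arithmetic). Inputs are addressed by index in a list (`tpI`, `tpF`, `tmem_tpF_tpI`), and a list of
expressions yields a `TPoly` (`tpmem_map_eval`), ready for the uniform sign checkers
`tpoly_pos_of_posOn` / `tpoly_neg_of_negOn`. Finally `pos_of_tlowerI_pos` / `neg_of_tupperI_neg`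
and `bounds_of_tmem` read real bounds off a Taylor model. Problem-independent; no facts, no axioms.

## References

* K. Makino, M. Berz, *Taylor models and other validated functional inclusion methods*,
  Int. J. Pure Appl. Math. 4 (2003), 379–456. [folklore]
* R. E. Moore, *Interval Analysis*, Prentice-Hall (1966), §3. [cite: Moore1966, Theorem 3.1]
-/

namespace Literature.Analysis.ValidatedNumerics

namespace PolyMP

open Literature.Analysis.ValidatedNumerics.NumericsMP

/-! ### The term language and its two semantics -/

/-- Polynomial expressions in indexed inputs with rational constants. [folklore] -/
inductive TExpr : Type
  /-- a rational constant -/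
  | cst (q : ℚ) : TExpr
  /-- the `i`-th input quantity -/
  | inp (i : ℕ) : TExpr
  /-- sum -/
  | add (a b : TExpr) : TExpr
  /-- difference -/
  | sub (a b : TExpr) : TExpr
  /-- product -/
  | mul (a b : TExpr) : TExpr
  /-- negation -/
  | neg (a : TExpr) : TExpr
  /-- integer multiple -/
  | smul (k : ℤ) (a : TExpr) : TExpr
  /-- division by a natural number (`/0 = 0`, as in `ℝ`) -/
  | sdiv (n : ℕ) (a : TExpr) : TExpr
  deriving Inhabited

namespace TExpr

/-- Real semantics: the function of the parameter `ρ` denoted by an expression, given the input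
functions `v`. [folklore] -/
noncomputable def evalF (v : ℕ → ℝ → ℝ) : TExpr → ℝ → ℝ
  | cst q => fun _ => (q : ℝ)
  | inp i => v i
  | add a b => fun ρ => a.evalF v ρ + b.evalF v ρ
  | sub a b => fun ρ => a.evalF v ρ - b.evalF v ρ
  | mul a b => fun ρ => a.evalF v ρ * b.evalF v ρ
  | neg a => fun ρ => -(a.evalF v ρ)
  | smul k a => fun ρ => (k : ℝ) * a.evalF v ρ
  | sdiv n a => fun ρ => a.evalF v ρ / n

/-- [folklore] -/
@[simp] theorem evalF_cst (v : ℕ → ℝ → ℝ) (q : ℚ) (ρ : ℝ) : (cst q).evalF v ρ = q := rfl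
/-- [folklore] -/
@[simp] theorem evalF_inp (v : ℕ → ℝ → ℝ) (i : ℕ) : (inp i).evalF v = v i := rfl
/-- [folklore] -/
@[simp] theorem evalF_add (v : ℕ → ℝ → ℝ) (a b : TExpr) (ρ : ℝ) :
    (add a b).evalF v ρ = a.evalF v ρ + b.evalF v ρ := rfl
/-- [folklore] -/
@[simp] theorem evalF_sub (v : ℕ → ℝ → ℝ) (a b : TExpr) (ρ : ℝ) :
    (sub a b).evalF v ρ = a.evalF v ρ - b.evalF v ρ := rfl
/-- [folklore] -/
@[simp] theorem evalF_mul (v : ℕ → ℝ → ℝ) (a b : TExpr) (ρ : ℝ) :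
    (mul a b).evalF v ρ = a.evalF v ρ * b.evalF v ρ := rfl
/-- [folklore] -/
@[simp] theorem evalF_neg (v : ℕ → ℝ → ℝ) (a : TExpr) (ρ : ℝ) :
    (neg a).evalF v ρ = -(a.evalF v ρ) := rfl
/-- [folklore] -/
@[simp] theorem evalF_smul (v : ℕ → ℝ → ℝ) (k : ℤ) (a : TExpr) (ρ : ℝ) :
    (smul k a).evalF v ρ = (k : ℝ) * a.evalF v ρ := rfl
/-- [folklore] -/
@[simp] theorem evalF_sdiv (v : ℕ → ℝ → ℝ) (n : ℕ) (a : TExpr) (ρ : ℝ) :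
    (sdiv n a).evalF v ρ = a.evalF v ρ / n := rfl

/-- Taylor-model semantics: evaluation in the Taylor-model arithmetic of `TaylorModel.lean`
(scale `S`, radius `h`, truncation degree `D`), given the input models `V`. Computable, reducible
in the kernel. [folklore] -/
def evalT (S : ℕ) (h : ℚ) (D : ℕ) (V : ℕ → IPoly) : TExpr → IPoly
  | cst q => tconst (ofRat S q)
  | inp i => V i
  | add a b => taddI (a.evalT S h D V) (b.evalT S h D V)
  | sub a b => tsubI (a.evalT S h D V) (b.evalT S h D V)
  | mul a b => tmulI S h D (a.evalT S h D V) (b.evalT S h D V)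
  | neg a => tnegI (a.evalT S h D V)
  | smul k a => tsmulInt k (a.evalT S h D V)
  | sdiv n a => if 0 < n then tdivNat n (a.evalT S h D V) else tzero S

/-- **Soundness of the Taylor-model evaluation.** If each input function is enclosed by its input
model on `|ρ| ≤ h`, then the function denoted by `e` is enclosed by `e.evalT`. [folklore] -/
theorem tmem_evalT {S : ℕ} (hS : 0 < S) {h : ℚ} (h0 : 0 ≤ h) (D : ℕ) {v : ℕ → ℝ → ℝ}
    {V : ℕ → IPoly} (hv : ∀ i, TMem S h (v i) (V i)) :
    ∀ e : TExpr, TMem S h (e.evalF v) (e.evalT S h D V)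
  | cst q => by
      simpa [evalF, evalT] using tmem_const (S := S) (h := h) (x := (q : ℝ)) (mem_ofRat S q)
  | inp i => by simpa [evalF, evalT] using hv i
  | add a b => by
      simpa [evalF, evalT] using tmem_add (tmem_evalT hS h0 D hv a) (tmem_evalT hS h0 D hv b)
  | sub a b => by
      simpa [evalF, evalT] using tmem_sub (tmem_evalT hS h0 D hv a) (tmem_evalT hS h0 D hv b)
  | mul a b => by
      simpa [evalF, evalT] using tmem_mul hS h0 D (tmem_evalT hS h0 D hv a) (tmem_evalT hS h0 D hv b)
  | neg a => by
      simpa [evalF, evalT] using tmem_neg (tmem_evalT hS h0 D hv a)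
  | smul k a => by
      simpa [evalF, evalT] using tmem_smulInt k (tmem_evalT hS h0 D hv a)
  | sdiv n a => by
      by_cases hn : 0 < n
      · simpa [evalF, evalT, hn] using tmem_divNat hn (tmem_evalT hS h0 D hv a)
      · have hn0 : n = 0 := by omega
        subst hn0
        have e0 : (sdiv 0 a).evalF v = (0 : ℝ → ℝ) := by
          funext ρ; simp [evalF]
        rw [e0]
        simpa [evalT] using tmem_zero S h

end TExpr

/-! ### Inputs and outputs as lists -/

/-- Input models from a list (the zero model past its end). [folklore] -/
def tpI (S : ℕ) (l : List IPoly) : ℕ → IPoly := fun i => l.getD i (tzero S)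

/-- Input functions from a list (the zero function past its end). [folklore] -/
noncomputable def tpF (l : List (ℝ → ℝ)) : ℕ → ℝ → ℝ := fun i => l.getD i 0

/-- [folklore] -/
@[simp] theorem tpF_cons_zero (f : ℝ → ℝ) (l : List (ℝ → ℝ)) : tpF (f :: l) 0 = f := rfl
/-- [folklore] -/
@[simp] theorem tpF_cons_succ (f : ℝ → ℝ) (l : List (ℝ → ℝ)) (n : ℕ) :
    tpF (f :: l) (n + 1) = tpF l n := rfl
/-- [folklore] -/
@[simp] theorem tpF_nil (n : ℕ) : tpF [] n = 0 := rfl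
/-- [folklore] -/
@[simp] theorem tpI_cons_zero (S : ℕ) (P : IPoly) (l : List IPoly) : tpI S (P :: l) 0 = P := rfl
/-- [folklore] -/
@[simp] theorem tpI_cons_succ (S : ℕ) (P : IPoly) (l : List IPoly) (n : ℕ) :
    tpI S (P :: l) (n + 1) = tpI S l n := rfl
/-- [folklore] -/
@[simp] theorem tpI_nil (S : ℕ) (n : ℕ) : tpI S [] n = tzero S := rfl

/-- Input memberships from a coefficientwise membership of the lists. [folklore] -/
theorem tmem_tpF_tpI {S : ℕ} {h : ℚ} {fs : List (ℝ → ℝ)} {Ps : List IPoly}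
    (hP : TPMem S h fs Ps) : ∀ i, TMem S h (tpF fs i) (tpI S Ps i) := by
  intro i
  induction hP generalizing i with
  | nil => simpa using tmem_zero S h
  | @cons f P fs' Ps' hf _ ih =>
    cases i with
    | zero => simpa using hf
    | succ n => simpa using ih n

/-- A list of expressions evaluates to a `TPoly` enclosing the list of denoted functions.
[folklore] -/
theorem tpmem_map_eval {S : ℕ} (hS : 0 < S) {h : ℚ} (h0 : 0 ≤ h) (D : ℕ) {v : ℕ → ℝ → ℝ}
    {V : ℕ → IPoly} (hv : ∀ i, TMem S h (v i) (V i)) :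
    ∀ es : List TExpr,
      TPMem S h (es.map (fun e => e.evalF v)) (es.map (fun e => e.evalT S h D V))
  | [] => tpmem_nil S h
  | e :: es => tpmem_cons (TExpr.tmem_evalT hS h0 D hv e) (tpmem_map_eval hS h0 D hv es)

/-! ### Reading real bounds off a Taylor model -/

/-- A quantity whose model has positive lower bound is positive. [folklore] -/
theorem pos_of_tlowerI_pos {S : ℕ} {h : ℚ} (h0 : 0 ≤ h) {f : ℝ → ℝ} {P : IPoly}
    (hf : TMem S h f P) (hpos : 0 < tlowerI S h P) {ρ : ℝ} (hρ : |ρ| ≤ h) : 0 < f ρ := by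
  have h1 := tlowerI_le h0 hf hρ
  have h2 : (0 : ℝ) < (tlowerI S h P : ℝ) := by exact_mod_cast hpos
  have hS0 : (0 : ℝ) ≤ S := by positivity
  by_contra hcon
  push Not at hcon
  nlinarith

/-- A quantity whose model has negative upper bound is negative. [folklore] -/
theorem neg_of_tupperI_neg {S : ℕ} {h : ℚ} (h0 : 0 ≤ h) {f : ℝ → ℝ} {P : IPoly}
    (hf : TMem S h f P) (hneg : tupperI S h P < 0) {ρ : ℝ} (hρ : |ρ| ≤ h) : f ρ < 0 := by
  have h1 := le_tupperI h0 hf hρ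
  have h2 : (tupperI S h P : ℝ) < 0 := by exact_mod_cast hneg
  have hS0 : (0 : ℝ) ≤ S := by positivity
  by_contra hcon
  push Not at hcon
  nlinarith

/-- Rational bounds of a quantity from its model: if `lo · S ≤ tlowerI` and `tupperI ≤ hi · S`
then `lo ≤ f ρ ≤ hi`. [folklore] -/
theorem bounds_of_tmem {S : ℕ} (hS : 0 < S) {h : ℚ} (h0 : 0 ≤ h) {f : ℝ → ℝ} {P : IPoly}
    (hf : TMem S h f P) {lo hi : ℚ} (hlo : lo * S ≤ tlowerI S h P) (hhi : tupperI S h P ≤ hi * S)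
    {ρ : ℝ} (hρ : |ρ| ≤ h) : (lo : ℝ) ≤ f ρ ∧ f ρ ≤ hi := by
  have h1 := tlowerI_le h0 hf hρ
  have h2 := le_tupperI h0 hf hρ
  have hS1 : (0 : ℝ) < S := by exact_mod_cast hS
  have hlo' : ((lo : ℚ) : ℝ) * S ≤ (tlowerI S h P : ℝ) := by exact_mod_cast hlo
  have hhi' : (tupperI S h P : ℝ) ≤ ((hi : ℚ) : ℝ) * S := by exact_mod_cast hhi
  constructor
  · nlinarith
  · nlinarith

/-! ### Thin models (candidates for the verified inverse / square root) -/

/-- The thin interval polynomial with scaled integer coefficients `ns`. [folklore] -/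
def thinI (ns : List ℤ) : IPoly := ns.map (fun n => (⟨n, n⟩ : MI))

/-- The real polynomial `Σ (nᵢ/S) ρⁱ` denoted by a thin model. [folklore] -/
noncomputable def thinF (S : ℕ) (ns : List ℤ) : ℝ → ℝ :=
  fun ρ => evalR (ns.map (fun n : ℤ => (n : ℝ) / S)) ρ

/-- [folklore] -/
theorem pmem_thin (S : ℕ) (hS : 0 < S) :
    ∀ ns : List ℤ, PMem S (ns.map (fun n : ℤ => (n : ℝ) / S)) (thinI ns)
  | [] => by simpa [thinI] using pmem_nil S
  | n :: ns => by
      simp only [List.map_cons, thinI]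
      have hS' : (S : ℝ) ≠ 0 := by exact_mod_cast hS.ne'
      refine pmem_cons ⟨?_, ?_⟩ (by simpa [thinI] using pmem_thin S hS ns)
      · rw [div_mul_cancel₀ _ hS']
      · rw [div_mul_cancel₀ _ hS']

/-- A thin model encloses the polynomial it denotes (on any radius). [folklore] -/
theorem tmem_thin {S : ℕ} (hS : 0 < S) (h : ℚ) (ns : List ℤ) : TMem S h (thinF S ns) (thinI ns) :=
  fun _ _ => ⟨ns.map (fun n : ℤ => (n : ℝ) / S), pmem_thin S hS ns, rfl⟩

end PolyMP

end Literature.Analysis.ValidatedNumerics
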